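import Summits.QuantumFields.BalabanUV.T4Continuum.Support.NE3BlockLineAverage
import Summits.QuantumFields.BalabanUV.T4Continuum.Support.SkeletonLattice
import HarnessLib

/-!
# NE3FramePotGauge (T⁴ programme, node NE3, row NE3-R2 supplement to E-MLw-(w4)) — THE FRAME POTENTIAL OF A PURE GAUGE IS A
# BLOCK MEAN: `framePot L k (dPot ξ) z = (bmean L)^[k] ξ z − ξ(L^k•z)`; every flat k-fold tangent direction is corner-trivially
# gauge-equivalent to a FRAME-FREE one (`framePot = 0`, hence `(Qcoarse L)^[k] = 0`)

HONEST FRAMING (cell `pub-balaban`, T4-DAG PAGE 1; unit `b2b-balaban-t4-ne3r2-p1` = owner of BINDER-OWNERS row NE3-R2, gen 6; FINDING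
F-ne3r2-g6-1, memo `t4/b2b-balaban-t4-ne3r2-p1/gen6/F-ne3r2-g6-muK.md`).  The cell's T4 target is the finite-torus continuum limit of
the unit-scale averaged loop expectations — NOT infinite volume, NO mass gap, NOT Clay, NOT summit progress.  WHY.  The NE3 owner's
(w4)-P design (D-ne3p1-g21-1) meets its wall (μK) where the accumulated frame potential `framePot L k Y` of a tangent direction
(`NE3TangentFlatStructure`: `(Tcoarse L)^[k] Y = (Qcoarse L)^[k] Y − dPot (framePot L k Y)`) is paired with curvature.  THIS FILE is
the flat kernel fact behind the alternative «frame-free slice» of the FINDING: the frame potential of a coboundary telescopes to a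
block mean, so it can be GAUGED AWAY by a corner-trivial gauge transformation, after which the straight k-fold average vanishes.
All [folklore], 0 sorry, values in any normed ℂ-algebra `𝔸`:
§1 `bmean L Φ w = Σ_r L^{−d} Φ(L•w + r)` (the block mean read on the coarse lattice); `Qcoarse_dPot_eq` (leaf-04's `Qcoarse_dPot`
   as an identity of functions), **`Fcoarse_dPot`**: `F̂(dΦ)(L•w) = bmean Φ w − Φ(L•w)`, `iterate_Qcoarse_dPot`:
   `(Qcoarse L)^[j] (dPot Φ) = dPot ((bmean L)^[j] Φ)`, **`framePot_dPot`** (‡): `framePot L k (dPot Φ) z = (bmean L)^[k] Φ z − Φ((L^k)•z)`,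
   `iterate_Tcoarse_dPot`: `(Tcoarse L)^[k] (dPot Φ) = dPot (Φ ∘ (L^k•))`;
§2 the tiling `iterate_bmean_apply`: `(bmean L)^[k] Φ z = (L^{kd})⁻¹ • Σ_{v∈[0,L^k)^d} Φ(L^k•z + v)` (leaf-04's `sum_periodBox_blocks`);
§3 additivity: `Fcoarse_add`, `Qcoarse_add`, `Tcoarse_add`, their iterates, `framePot_add`;
§4 `cornerGauge` (block-constant, corners zeroed; `(M·P)`-periodic for `P`-periodic data, `cornerGauge_add_period`;
   `iterate_bmean_cornerGauge`), the FRAME-KILLING GAUGE `frameKill L k Y = cornerGauge (L^k) (−(M^d∕(M^d−1))•framePot L k Y)`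
   (`frameKill_corner`, `frameKill_add_period`), **`framePot_add_frameKill`**: `framePot L k (Y + dPot (frameKill L k Y)) = 0`,
   `iterate_Tcoarse_add_frameKill` (tangency unchanged), **`iterate_Qcoarse_add_frameKill`**: `(Tcoarse L)^[k] Y = 0 ⟹
   (Qcoarse L)^[k] (Y + dPot (frameKill L k Y)) = 0`, packaged as **`exists_frameFree_repr`** (`L ≥ 1`, `(L^k)^d ≥ 2`);
§5∕§6 (the N-free block Poincaré END and the slice `frameFreeBlockLandau` as a Set) are file 2 `NE3FrameFreeSlice`.
Nothing about Bałaban's minimisers, (P_W), (ML_w), T-E_w or NE3 is asserted; NE3 NOT proved; spine 0∕9; rung (B)+1.  ABSOLUTE RULE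
kept: no printed sentence is a hypothesis (context: [Balaban1985Averaging] (47)–(48) p. 25, (112) p. 34, (120)–(125) pp. 35–36).
PLACEMENT: `Summits/QuantumFields/BalabanUV/`; imports the crew's `NE3BlockLineAverage` (hence `NE3TangentFlatStructure`) and the tree's
`SkeletonLattice` (`cdiv`) BY NAME; moves nothing.
-/

set_option autoImplicit false

open scoped BigOperators
open Finset

namespace Summit.QuantumFields.BalabanUV.T4Continuum.NE3FramePotGauge

open Literature.MathematicalPhysics.QuantumFieldTheory.Balaban1983to89
open B7Prop1Explicit B7Prop3Flat
open T4AveragingDeficitWallBoundary (periodBox mem_periodBox card_periodBox)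
open SmoothRefineNeutral (Tcoarse)
open NE3TangentNoGoWords (dPot asum_dPot)
open NE3TangentNoGoFlat (asum_add')
open NE3TangentFlatStructure (Qcoarse Fcoarse framePot framePot_zero framePot_succ Qcoarse_dPot Tcoarse_dPot dPot_add
  iterate_Tcoarse_eq_zero_iff framePot_add_period dPot_add_period)
open NE3BlockLineAverage (sum_univ_boxVec sum_periodBox_blocks)
open SkeletonLattice (cdiv cdiv_eq_of_repr)

noncomputable section

variable {d : ℕ} {𝔸 : Type*} [NormedRing 𝔸] [NormedAlgebra ℂ 𝔸]

/-! ## §1 The frame potential of a coboundary -/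

/-- THE BLOCK MEAN read on the coarse lattice: `bmean L Φ w = Σ_{r∈[0,L)^d} L^{−d} Φ(L•w + r)`. [folklore] -/
def bmean (L : ℕ) (Φ : Site d → 𝔸) : Site d → 𝔸 :=
  fun w => ∑ r : Fin d → Fin L, (((L : ℝ) ^ d)⁻¹ : ℝ) • Φ ((L : ℤ) • w + boxVec L r)

/-- The straight average of a coboundary is the coboundary of the block mean (leaf-04's `Qcoarse_dPot`, as functions). [folklore] -/
theorem Qcoarse_dPot_eq (L : ℕ) (Φ : Site d → 𝔸) : Qcoarse L (dPot Φ) = dPot (bmean L Φ) := by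
  funext z κ
  exact Qcoarse_dPot L Φ z κ

omit [NormedRing 𝔸] [NormedAlgebra ℂ 𝔸] in
/-- The weights `L^{−d}` over `[0,L)^d` sum to one (`L ≥ 1`). [folklore] -/
theorem sum_weight_smul {E : Type*} [AddCommGroup E] [Module ℝ E] {L : ℕ} (hL : 1 ≤ L) (X : E) :
    ∑ _r : Fin d → Fin L, (((L : ℝ) ^ d)⁻¹ : ℝ) • X = X := by
  rw [Finset.sum_const, Finset.card_univ, Fintype.card_fun, Fintype.card_fin, Fintype.card_fin, ← Nat.cast_smul_eq_nsmul ℝ,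
    smul_smul]
  have hL0 : ((L : ℝ) ^ d) ≠ 0 := pow_ne_zero _ (by exact_mod_cast (by omega : L ≠ 0))
  rw [show ((L ^ d : ℕ) : ℝ) = (L : ℝ) ^ d by push_cast; ring, mul_inv_cancel₀ hL0, one_smul]

/-- **THE LINEARISED FRAME OF A COBOUNDARY**: `Fcoarse L (dPot Φ) w = bmean L Φ w − Φ(L•w)` (the contour sum of an exact
cochain is the potential difference of the end points; the weights sum to one). [folklore] -/
theorem Fcoarse_dPot {L : ℕ} (hL : 1 ≤ L) (Φ : Site d → 𝔸) (w : Site d) :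
    Fcoarse L (dPot Φ) w = bmean L Φ w - Φ ((L : ℤ) • w) := by
  simp only [Fcoarse, Fhat, bmean, asum_dPot, disp_treeWord, smul_sub, Finset.sum_sub_distrib, sum_weight_smul hL]

/-- `(Qcoarse L)^[j] (dPot Φ) = dPot ((bmean L)^[j] Φ)`. [folklore] -/
theorem iterate_Qcoarse_dPot (L : ℕ) : ∀ (j : ℕ) (Φ : Site d → 𝔸), (Qcoarse L)^[j] (dPot Φ) = dPot ((bmean L)^[j] Φ)
  | 0, _ => rfl
  | j + 1, Φ => by
      rw [Function.iterate_succ_apply, Function.iterate_succ_apply (bmean L), Qcoarse_dPot_eq]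
      exact iterate_Qcoarse_dPot L j (bmean L Φ)

/-- **(‡) THE FRAME POTENTIAL OF A COBOUNDARY IS A BLOCK MEAN**: `framePot L k (dPot Φ) z = (bmean L)^[k] Φ z − Φ((L^k)•z)`
(telescoping of `framePot_succ` through `Fcoarse_dPot` and `iterate_Qcoarse_dPot`). [folklore] -/
theorem framePot_dPot {L : ℕ} (hL : 1 ≤ L) : ∀ (k : ℕ) (Φ : Site d → 𝔸) (z : Site d),
    framePot L k (dPot Φ) z = (bmean L)^[k] Φ z - Φ (((L : ℤ) ^ k) • z)
  | 0, Φ, z => by simp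
  | k + 1, Φ, z => by
      rw [framePot_succ, iterate_Qcoarse_dPot, Fcoarse_dPot hL, framePot_dPot hL k Φ, Function.iterate_succ_apply' (bmean L) k Φ,
        pow_succ, ← smul_smul]
      abel

/-- `(Tcoarse L)^[k] (dPot Φ) = dPot (Φ ∘ (L^k•))` (`L ≥ 1`): the k-fold contour average of a coboundary is the coboundary of the
potential read on the corners. [folklore] -/
theorem iterate_Tcoarse_dPot {L : ℕ} (hL : 1 ≤ L) : ∀ (k : ℕ) (Φ : Site d → 𝔸),
    (Tcoarse L)^[k] (dPot Φ) = dPot (fun w => Φ (((L : ℤ) ^ k) • w))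
  | 0, Φ => by simp
  | k + 1, Φ => by
      have h1 : Tcoarse L (dPot Φ) = dPot (fun w => Φ ((L : ℤ) • w)) :=
        funext fun z => funext fun κ => Tcoarse_dPot hL Φ z κ
      rw [Function.iterate_succ_apply, h1, iterate_Tcoarse_dPot hL k]
      congr 1
      funext w
      rw [pow_succ', mul_smul]

/-! ## §2 The tiling of the iterated block mean -/

/-- One level written out: `bmean L Φ w = (L^d)⁻¹ • Σ_{v∈[0,L)^d} Φ(L•w + v)`. [folklore] -/
theorem bmean_apply (L : ℕ) (Φ : Site d → 𝔸) (w : Site d) :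
    bmean L Φ w = (((L : ℝ) ^ d)⁻¹ : ℝ) • ∑ v ∈ periodBox (d := d) L, Φ ((L : ℤ) • w + v) := by
  unfold bmean
  rw [Finset.smul_sum, ← sum_univ_boxVec]

/-- **THE k-FOLD BLOCK MEAN IS THE `L^k`-BLOCK MEAN**: `(bmean L)^[k] Φ z = ((L^k)^d)⁻¹ • Σ_{v∈[0,L^k)^d} Φ(L^k•z + v)` (`L ≥ 1`;
the `L`-digits of the offset split off, `sum_periodBox_blocks`). [folklore] -/
theorem iterate_bmean_apply {L : ℕ} (hL : 1 ≤ L) : ∀ (k : ℕ) (Φ : Site d → 𝔸) (z : Site d),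
    (bmean L)^[k] Φ z
      = ((((L ^ k : ℕ) : ℝ) ^ d)⁻¹ : ℝ) • ∑ v ∈ periodBox (d := d) (L ^ k), Φ (((L ^ k : ℕ) : ℤ) • z + v)
  | 0, Φ, z => by
      have hbox : periodBox (d := d) 1 = {0} := by
        ext v
        rw [mem_periodBox, Finset.mem_singleton]
        constructor
        · intro h; funext κ'; have := h κ'; simp only [Nat.cast_one, Pi.zero_apply] at this ⊢; omega
        · rintro rfl κ'; simp
      simp [hbox]
  | k + 1, Φ, z => by
      have hM : 1 ≤ L ^ k := Nat.one_le_pow _ _ hL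
      rw [Function.iterate_succ_apply', bmean_apply]
      simp_rw [iterate_bmean_apply hL k]
      rw [show (L ^ (k + 1) : ℕ) = L ^ k * L from pow_succ L k]
      simp_rw [← Finset.smul_sum]
      rw [smul_smul]
      have hscal : (((L : ℝ) ^ d)⁻¹ : ℝ) * ((((L ^ k : ℕ) : ℝ) ^ d)⁻¹ : ℝ) = ((((L ^ k * L : ℕ) : ℝ) ^ d)⁻¹ : ℝ) := by
        push_cast
        rw [← mul_inv, ← mul_pow, mul_comm ((L : ℝ)) ((L : ℝ) ^ k)]
      rw [hscal]
      congr 1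
      calc ∑ v ∈ periodBox (d := d) L, ∑ w ∈ periodBox (d := d) (L ^ k), Φ (((L ^ k : ℕ) : ℤ) • ((L : ℤ) • z + v) + w)
          = ∑ v ∈ periodBox (d := d) L, ∑ w ∈ periodBox (d := d) (L ^ k),
              Φ (((L ^ k * L : ℕ) : ℤ) • z + (((L ^ k : ℕ) : ℤ) • v + w)) := by
            refine Finset.sum_congr rfl fun v _ => Finset.sum_congr rfl fun w _ => ?_
            congr 1
            push_cast
            simp only [smul_add, smul_smul, mul_comm ((L : ℤ) ^ k) (L : ℤ)]
            abel
        _ = ∑ u ∈ periodBox (d := d) (L ^ k * L), Φ (((L ^ k * L : ℕ) : ℤ) • z + u) :=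
            sum_periodBox_blocks (L ^ k) L hM (fun u => Φ (((L ^ k * L : ℕ) : ℤ) • z + u))

/-! ## §3 Additivity -/

/-- `Fcoarse` is additive. [folklore] -/
theorem Fcoarse_add (L : ℕ) (A B : Site d → Fin d → 𝔸) (w : Site d) :
    Fcoarse L (fun y μ => A y μ + B y μ) w = Fcoarse L A w + Fcoarse L B w := by
  simp only [Fcoarse, Fhat, asum_add', smul_add, Finset.sum_add_distrib]

/-- `Qcoarse` is additive. [folklore] -/
theorem Qcoarse_add (L : ℕ) (A B : Site d → Fin d → 𝔸) :
    Qcoarse L (fun y μ => A y μ + B y μ) = fun z κ => Qcoarse L A z κ + Qcoarse L B z κ := by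
  funext z κ
  simp only [Qcoarse, linQ, asum_add', smul_add, Finset.sum_add_distrib]

/-- `Tcoarse` is additive. [folklore] -/
theorem Tcoarse_add (L : ℕ) (A B : Site d → Fin d → 𝔸) :
    Tcoarse L (fun y μ => A y μ + B y μ) = fun z κ => Tcoarse L A z κ + Tcoarse L B z κ := by
  funext z κ
  simp only [Tcoarse, Tside, asum_add', smul_add, Finset.sum_add_distrib]

/-- The iterated straight average is additive. [folklore] -/
theorem iterate_Qcoarse_add (L : ℕ) : ∀ (j : ℕ) (A B : Site d → Fin d → 𝔸),
    (Qcoarse L)^[j] (fun y μ => A y μ + B y μ) = fun z κ => (Qcoarse L)^[j] A z κ + (Qcoarse L)^[j] B z κ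
  | 0, _, _ => rfl
  | j + 1, A, B => by
      rw [Function.iterate_succ_apply, Qcoarse_add, iterate_Qcoarse_add L j]
      rfl

/-- The iterated contour average is additive. [folklore] -/
theorem iterate_Tcoarse_add (L : ℕ) : ∀ (j : ℕ) (A B : Site d → Fin d → 𝔸),
    (Tcoarse L)^[j] (fun y μ => A y μ + B y μ) = fun z κ => (Tcoarse L)^[j] A z κ + (Tcoarse L)^[j] B z κ
  | 0, _, _ => rfl
  | j + 1, A, B => by
      rw [Function.iterate_succ_apply, Tcoarse_add, iterate_Tcoarse_add L j]
      rfl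

/-- The frame potential is additive. [folklore] -/
theorem framePot_add (L : ℕ) : ∀ (k : ℕ) (A B : Site d → Fin d → 𝔸) (z : Site d),
    framePot L k (fun y μ => A y μ + B y μ) z = framePot L k A z + framePot L k B z
  | 0, _, _, _ => by simp
  | k + 1, A, B, z => by
      rw [framePot_succ, framePot_succ, framePot_succ, iterate_Qcoarse_add, Fcoarse_add, framePot_add L k]
      abel

/-! ## §4 Gauging the frame potential away -/

/-- THE CORNER-TRIVIAL BLOCK-CONSTANT GAUGE: `cornerGauge M θ x = θ(⌊x∕M⌋)` off the block corners `M•ℤ^d`, `0` on them. [folklore] -/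
def cornerGauge (M : ℕ) (θ : Site d → 𝔸) (x : Site d) : 𝔸 :=
  if x = (M : ℤ) • cdiv M x then 0 else θ (cdiv M x)

omit [NormedAlgebra ℂ 𝔸] in
/-- `cornerGauge` vanishes on the corners. [folklore] -/
theorem cornerGauge_corner {M : ℕ} (hM : 1 ≤ M) (θ : Site d → 𝔸) (w : Site d) :
    cornerGauge M θ ((M : ℤ) • w) = 0 := by
  have hc : cdiv M ((M : ℤ) • w) = w :=
    cdiv_eq_of_repr (q := 0) (by simp) (fun _ => le_rfl)
      (fun _ => by simp only [Pi.zero_apply]; exact_mod_cast (by omega : 0 < M))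
  unfold cornerGauge
  rw [hc]
  exact if_pos rfl

omit [NormedAlgebra ℂ 𝔸] in
/-- Off the corner of its block, `cornerGauge` is the block constant: for `v ∈ [0,M)^d`, `v ≠ 0`,
`cornerGauge M θ (M•z + v) = θ z`. [folklore] -/
theorem cornerGauge_off_corner (M : ℕ) (θ : Site d → 𝔸) (z : Site d) {v : Site d} (hv : v ∈ periodBox (d := d) M)
    (hv0 : v ≠ 0) : cornerGauge M θ ((M : ℤ) • z + v) = θ z := by
  have hb := mem_periodBox.mp hv
  have hc : cdiv M ((M : ℤ) • z + v) = z := cdiv_eq_of_repr rfl (fun i => (hb i).1) (fun i => (hb i).2)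
  have hne : (M : ℤ) • z + v ≠ (M : ℤ) • cdiv M ((M : ℤ) • z + v) := by
    rw [hc]
    intro h
    exact hv0 (by simpa using h)
  unfold cornerGauge
  rw [if_neg hne, hc]

omit [NormedAlgebra ℂ 𝔸] in
/-- The corner gauge of a `P`-periodic block potential is `(M·P)`-periodic (`M ≥ 1`). [folklore] -/
theorem cornerGauge_add_period {M : ℕ} (hM : 1 ≤ M) {θ : Site d → 𝔸} {P : ℤ}
    (hθ : ∀ (z : Site d) (τ : Fin d), θ (z + P • e τ) = θ z) (x : Site d) (τ : Fin d) :
    cornerGauge M θ (x + ((M : ℤ) * P) • e τ) = cornerGauge M θ x := by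
  have hc : cdiv M (x + ((M : ℤ) * P) • e τ) = cdiv M x + P • e τ := SkeletonLattice.cdiv_add_period hM P x τ
  have hiff : (x + ((M : ℤ) * P) • e τ = (M : ℤ) • (cdiv M x + P • e τ)) ↔ (x = (M : ℤ) • cdiv M x) := by
    rw [smul_add, smul_smul]
    constructor
    · intro h; exact add_right_cancel h
    · intro h; rw [← h]
  unfold cornerGauge
  rw [hc, hθ]
  by_cases hx : x = (M : ℤ) • cdiv M x
  · rw [if_pos hx, if_pos (hiff.mpr hx)]
  · rw [if_neg hx, if_neg (fun h => hx (hiff.mp h))]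

/-- **THE `L^k`-BLOCK MEAN OF THE CORNER GAUGE**: `(bmean L)^[k] (cornerGauge (L^k) θ) z = ((M^d − 1)∕M^d) • θ z`, `M = L^k`
(one corner per block carries `0`, the other `M^d − 1` sites carry `θ z`). [folklore] -/
theorem iterate_bmean_cornerGauge {L : ℕ} (hL : 1 ≤ L) (k : ℕ) (θ : Site d → 𝔸) (z : Site d) :
    (bmean L)^[k] (cornerGauge (L ^ k) θ) z
      = ((((L ^ k : ℕ) : ℝ) ^ d - 1) / (((L ^ k : ℕ) : ℝ) ^ d) : ℝ) • θ z := by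
  have hM : 1 ≤ L ^ k := Nat.one_le_pow _ _ hL
  rw [iterate_bmean_apply hL]
  have h0 : (0 : Site d) ∈ periodBox (d := d) (L ^ k) :=
    mem_periodBox.mpr fun _ => ⟨le_rfl, by simp only [Pi.zero_apply]; exact_mod_cast (by omega : 0 < L ^ k)⟩
  rw [← Finset.add_sum_erase _ _ h0, add_zero, cornerGauge_corner hM]
  have hrest : ∑ v ∈ (periodBox (d := d) (L ^ k)).erase 0, cornerGauge (L ^ k) θ (((L ^ k : ℕ) : ℤ) • z + v)
      = ∑ _v ∈ (periodBox (d := d) (L ^ k)).erase 0, θ z :=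
    Finset.sum_congr rfl fun v hv =>
      cornerGauge_off_corner (L ^ k) θ z (Finset.mem_of_mem_erase hv) (Finset.ne_of_mem_erase hv)
  rw [zero_add, hrest, Finset.sum_const, Finset.card_erase_of_mem h0, card_periodBox, ← Nat.cast_smul_eq_nsmul ℝ, smul_smul]
  congr 1
  rw [Nat.cast_sub (Nat.one_le_pow _ _ hM)]
  push_cast
  ring

/-- A CORNER-TRIVIAL gauge shifts the frame potential by its block means:
`framePot L k (Y + dPot ξ) z = framePot L k Y z + (bmean L)^[k] ξ z` when `ξ(L^k•w) = 0`. [folklore] -/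
theorem framePot_add_dPot_of_corner {L : ℕ} (hL : 1 ≤ L) (k : ℕ) (Y : Site d → Fin d → 𝔸) {ξ : Site d → 𝔸}
    (hξ : ∀ w : Site d, ξ (((L : ℤ) ^ k) • w) = 0) (z : Site d) :
    framePot L k (fun y μ => Y y μ + dPot ξ y μ) z = framePot L k Y z + (bmean L)^[k] ξ z := by
  rw [framePot_add, framePot_dPot hL, hξ, sub_zero]

/-- TANGENCY IS INVARIANT UNDER CORNER-TRIVIAL GAUGES: `(Tcoarse L)^[k] (Y + dPot ξ) = (Tcoarse L)^[k] Y` when `ξ(L^k•w) = 0`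
(the k-fold contour average of `dPot ξ` is the coboundary of `ξ` read on the corners). [folklore] -/
theorem iterate_Tcoarse_add_dPot_of_corner {L : ℕ} (hL : 1 ≤ L) (k : ℕ) (Y : Site d → Fin d → 𝔸) {ξ : Site d → 𝔸}
    (hξ : ∀ w : Site d, ξ (((L : ℤ) ^ k) • w) = 0) :
    (Tcoarse L)^[k] (fun y μ => Y y μ + dPot ξ y μ) = (Tcoarse L)^[k] Y := by
  rw [iterate_Tcoarse_add, iterate_Tcoarse_dPot hL]
  funext z κ
  simp only [dPot, hξ, sub_self, add_zero]

/-- **TANGENT ∧ FRAME-FREE ⟹ THE STRAIGHT k-FOLD AVERAGE VANISHES**: `(Tcoarse L)^[k] X = 0` and `framePot L k X = 0` give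
`(Qcoarse L)^[k] X = 0` (the frames are coarse-exact, `iterate_Tcoarse_eq_zero_iff`). [folklore] -/
theorem iterate_Qcoarse_eq_zero_of_tangent_of_framePot {L : ℕ} (hL : 1 ≤ L) {k : ℕ} (X : Site d → Fin d → 𝔸)
    (hT : (Tcoarse L)^[k] X = 0) (hF : ∀ z : Site d, framePot L k X z = 0) : (Qcoarse L)^[k] X = 0 := by
  rw [(iterate_Tcoarse_eq_zero_iff hL k X).mp hT]
  funext z κ
  simp only [dPot, hF, sub_self, Pi.zero_apply]

/-- THE FRAME-KILLING GAUGE of a direction `Y` at `k` levels: the corner gauge of the block potential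
`θ = −(M^d∕(M^d−1))•framePot L k Y`, `M = L^k`. [folklore] -/
def frameKill (L k : ℕ) (Y : Site d → Fin d → 𝔸) : Site d → 𝔸 :=
  cornerGauge (L ^ k)
    (fun z => (-((((L ^ k : ℕ) : ℝ) ^ d) / ((((L ^ k : ℕ) : ℝ) ^ d) - 1)) : ℝ) • framePot L k Y z)

/-- `frameKill` is corner-trivial. [folklore] -/
theorem frameKill_corner {L : ℕ} (hL : 1 ≤ L) (k : ℕ) (Y : Site d → Fin d → 𝔸) (w : Site d) :
    frameKill L k Y (((L : ℤ) ^ k) • w) = 0 := by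
  have hcast : ((L : ℤ) ^ k) = ((L ^ k : ℕ) : ℤ) := by push_cast; ring
  rw [frameKill, hcast]
  exact cornerGauge_corner (Nat.one_le_pow _ _ hL) _ w

/-- `frameKill` of an `(L^k·P)`-periodic direction is `(L^k·P)`-periodic. [folklore] -/
theorem frameKill_add_period {L : ℕ} (hL : 1 ≤ L) (k : ℕ) {Y : Site d → Fin d → 𝔸} {P : ℤ}
    (hY : ∀ (y : Site d) (τ μ : Fin d), Y (y + ((L : ℤ) ^ k * P) • e τ) μ = Y y μ) (x : Site d) (τ : Fin d) :
    frameKill L k Y (x + ((L : ℤ) ^ k * P) • e τ) = frameKill L k Y x := by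
  have hcast : ((L : ℤ) ^ k) = ((L ^ k : ℕ) : ℤ) := by push_cast; ring
  rw [frameKill, hcast]
  refine cornerGauge_add_period (Nat.one_le_pow _ _ hL) (fun z τ' => ?_) x τ
  simp only [framePot_add_period L k Y hY z τ']

/-- **THE FRAME POTENTIAL IS GAUGED AWAY**: `framePot L k (Y + dPot (frameKill L k Y)) = 0` (`L ≥ 1`, `(L^k)^d ≥ 2`). [folklore] -/
theorem framePot_add_frameKill {L : ℕ} (hL : 1 ≤ L) {k : ℕ} (hMd : 2 ≤ (L ^ k) ^ d) (Y : Site d → Fin d → 𝔸) (z : Site d) :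
    framePot L k (fun y μ => Y y μ + dPot (frameKill L k Y) y μ) z = 0 := by
  set Md : ℝ := ((L ^ k : ℕ) : ℝ) ^ d with hMd_def
  have hMd2 : (2 : ℝ) ≤ Md := by
    rw [hMd_def]; exact_mod_cast (by simpa [Nat.cast_pow] using hMd)
  have hMd1 : Md - 1 ≠ 0 := by linarith
  have hMd0 : Md ≠ 0 := by linarith
  rw [framePot_add, framePot_dPot hL, frameKill_corner hL, sub_zero, frameKill, iterate_bmean_cornerGauge hL]
  simp only [smul_smul]
  rw [← hMd_def]
  have hc : (Md - 1) / Md * -(Md / (Md - 1)) = -1 := by field_simp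
  rw [hc, neg_one_smul, add_neg_cancel]

/-- Tangency is invariant under the (corner-trivial) frame-killing gauge: `(Tcoarse L)^[k] (Y + dPot (frameKill L k Y)) = (Tcoarse L)^[k] Y`. [folklore] -/
theorem iterate_Tcoarse_add_frameKill {L : ℕ} (hL : 1 ≤ L) (k : ℕ) (Y : Site d → Fin d → 𝔸) :
    (Tcoarse L)^[k] (fun y μ => Y y μ + dPot (frameKill L k Y) y μ) = (Tcoarse L)^[k] Y := by
  rw [iterate_Tcoarse_add, iterate_Tcoarse_dPot hL]
  funext z κ
  simp only [dPot, frameKill_corner hL, sub_self, add_zero]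

/-- **THE STRAIGHT k-FOLD AVERAGE OF THE FRAME-FREE REPRESENTATIVE VANISHES**: if `(Tcoarse L)^[k] Y = 0` then
`(Qcoarse L)^[k] (Y + dPot (frameKill L k Y)) = 0` (`L ≥ 1`, `(L^k)^d ≥ 2`). [folklore] -/
theorem iterate_Qcoarse_add_frameKill {L : ℕ} (hL : 1 ≤ L) {k : ℕ} (hMd : 2 ≤ (L ^ k) ^ d) (Y : Site d → Fin d → 𝔸)
    (hT : (Tcoarse L)^[k] Y = 0) :
    (Qcoarse L)^[k] (fun y μ => Y y μ + dPot (frameKill L k Y) y μ) = 0 := by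
  have hTan : (Tcoarse L)^[k] (fun y μ => Y y μ + dPot (frameKill L k Y) y μ) = 0 := by
    rw [iterate_Tcoarse_add_frameKill hL, hT]
  rw [(iterate_Tcoarse_eq_zero_iff hL k _).mp hTan]
  funext z κ
  have h1 := framePot_add_frameKill hL hMd Y (z + e κ)
  have h2 := framePot_add_frameKill hL hMd Y z
  simp only [dPot, Pi.zero_apply] at h1 h2 ⊢
  rw [h1, h2, sub_self]

/-- **EVERY FLAT k-FOLD TANGENT DIRECTION IS CORNER-TRIVIALLY GAUGE-EQUIVALENT TO A FRAME-FREE ONE.**  For `L ≥ 1`, `(L^k)^d ≥ 2`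
and `(Tcoarse L)^[k] Y = 0` there is a corner-trivial `ξ` (namely `frameKill L k Y`) with `framePot L k (Y + dPot ξ) = 0`,
`(Qcoarse L)^[k] (Y + dPot ξ) = 0` and `(Tcoarse L)^[k] (Y + dPot ξ) = 0`. [folklore] -/
theorem exists_frameFree_repr {L : ℕ} (hL : 1 ≤ L) {k : ℕ} (hMd : 2 ≤ (L ^ k) ^ d) (Y : Site d → Fin d → 𝔸)
    (hT : (Tcoarse L)^[k] Y = 0) :
    ∃ ξ : Site d → 𝔸, (∀ w : Site d, ξ (((L : ℤ) ^ k) • w) = 0)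
      ∧ (∀ z : Site d, framePot L k (fun y μ => Y y μ + dPot ξ y μ) z = 0)
      ∧ (Qcoarse L)^[k] (fun y μ => Y y μ + dPot ξ y μ) = 0
      ∧ (Tcoarse L)^[k] (fun y μ => Y y μ + dPot ξ y μ) = 0 :=
  ⟨frameKill L k Y, frameKill_corner hL k Y, framePot_add_frameKill hL hMd Y, iterate_Qcoarse_add_frameKill hL hMd Y hT,
    by rw [iterate_Tcoarse_add_frameKill hL, hT]⟩

end

end Summit.QuantumFields.BalabanUV.T4Continuum.NE3FramePotGauge
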